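import Literature.AnabelianGeometry.SemiGraphs.CoveringGraphChartGroup
import Literature.AnabelianGeometry.SemiGraphs.CoveringGraphGaloisCountable
import Literature.AnabelianGeometry.SemiGraphs.TemperedPiChartExists
import Literature.AnabelianGeometry.SemiGraphs.TemperedSpecialFibreTower
import HarnessLib

/-!
# The special-fibre tower of [SemiAnbd] Example 3.10 EXISTS over `π₁^temp(𝒢)` — fibres the covering
# semi-graphs of anabelioids of the levels (from Prop. 3.6 (v): tempered coverings are étale)

Mochizuki, *Semi-graphs of anabelioids*, Publ. RIMS **42** (2006), §3, Example 3.10, manuscript p. 44 l. 9 – p. 45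
l. 7 [cite: MochizukiSemiAnbd2006, Ex 3.10 p.44] ("Now suppose that we are given an exhaustive sequence of open
characteristic [hence normal] subgroups of finite index … `⊆ N_i ⊆ … ⊆ Δ` … Then `N_i` determines a finite [log] étale
covering … [whose special fiber] gives rise to semi-graphs of anabelioids `𝒢_i` … natural morphisms of temperoids
`… → B^temp(𝒢_i) → … → B^temp(𝒢)` … surjections of tempered groups `Δ ↠ … ↠ Δ[i] := π₁^temp(𝒢_i) ⋊^out Δ_i ↠ …`;
`Δ_i` acts faithfully"), with Prop. 3.6 (iv) "temp-slim" and (v) "`B^temp(G') → B^temp(G)` is étale" pp. 38–39, and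
[IUTchI] Rmk. 2.5.3 (i) (T3)/(T4) (strict coherence).

PROOF-ONLY file (abc-iut cell, layer L3; seat abc-iut-L3-t2 gen 4, owner lineage of the [SemiAnbd] §3 interface and of
the typed structure `SpecialFibreTower` (seat abc-iut-w5-d122); no definition, no instance, no new named fact).  The
COMBINATORIAL CORE of Example 3.10 as a kernel theorem — `SpecialFibreTower.exists_of_coverings`: for every
semi-graph of anabelioids `𝒢` satisfying the hypotheses of Thm. 3.7 and STRICTLY COHERENT (e.g. finite and coherent),
every tempered fundamental group chart `π₁^temp(𝒢) = c.G`, and EVERY exhaustive sequence `N` of open characteristic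
normal finite-index subgroups of `π₁^temp(𝒢)` (the printed data of p. 44 l. 9–11), there is a `SpecialFibreTower
(π₁^temp(𝒢))` WITH LEVELS `N` whose fibre `𝒢_i` IS the covering semi-graph of anabelioids `𝒢_{S_i}`
(`CovObj.coveringGraph`) of THE connected tempered covering `S_i ↔ N_i` (the object `π₁^temp(𝒢)/N_i` of
`B^temp(π₁^temp(𝒢)) ≌ B^temp(𝒢)`), which again satisfies the hypotheses of Thm. 3.7 (heredity, seat abc-iut-L3-d6's
`thm37Hypotheses_coveringGraph`), with chart `π₁^temp(𝒢_{S_i})` (Prop. 3.6 (i)(ii), `temperedPiChart`), admissible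
quotient `N_i ⥲ π₁^temp(𝒢_{S_i})` the ÉTALE identification of Prop. 3.6 (v) (seat abc-iut-L3-t9's
`exists_chartGroup_compatIso`: `π₁^temp(𝒢_S) ≅ Stab(x₀)`, an open stabiliser; here `Stab = N_i`, the stabiliser of a
coset of a normal subgroup), admissible kernel `1` (so `Δ[i] = Δ`), and faithfulness = temp-slimness of `π₁^temp(𝒢)`
(Prop. 3.6 (iv), `temperedPiSlim_holds`).  In words: given the special fibre `𝒢^c` of the curve, the printed tower
over its tempered fundamental group is a THEOREM of §3; what the interface's origin statement `Ex310TowerStatement`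
adds beyond this is only the identification of `Δ^temp_X` with `π₁^temp(𝒢^c)` along the admissible quotient and of
the `𝒢_i` with the special fibres of the curve coverings (geometry, not claimed).

HONEST LIMITS: strict coherence assumed ((T3); automatic for finite coherent `𝒢`); the fibres are the covering
semi-graphs of anabelioids of `𝒢^c` determined by the `N_i` (the COMBINATORIAL coverings), not the special fibres of
the corresponding coverings of a curve — the two agree in print only because the `N_i` lie over the admissible
quotient; nothing here is about curves.  Nothing of the paper is asserted beyond what is proved; no side is taken on
[IUTchIII] Cor. 3.12.
-/

noncomputable section

open CategoryTheory Topology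

namespace Literature.AnabelianGeometry.SemiGraphs

open Literature.AlgebraicGeometry.Frobenioids (IsSlimGroup IsConnectedObj)
open Literature.AlgebraicGeometry.Frobenioids.QuasiTemperoid.BTempConnected
  (hom_ρ ρ_one_apply ρ_mul_apply isConnectedObj_of_transitive)
open ProfiniteSemiGraph

universe u

/-! ### Stabilisers in `B^temp(Π)`: invariance under isomorphism; cosets of a normal subgroup -/

namespace BTemp

variable {G : Type u} [Group G] [TopologicalSpace G]

/-- Points of isomorphic objects of `B^temp(Π)` corresponding under the isomorphism have the same stabiliser
(equivariance). [cite: MochizukiSemiAnbd2006, Rmk 3.1.2 p.33] -/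
theorem mem_stab_iff_of_iso {X Y : BTemp G} (f : X ≅ Y) (x : X.obj.V) (g : G) :
    g ∈ BTemp.stab X x ↔ g ∈ BTemp.stab Y (f.hom.hom.hom x) := by
  have hinv : ∀ z : X.obj.V, (f.inv.hom.hom (f.hom.hom.hom z) : X.obj.V) = z := fun z => by
    have h1 : ((f.hom ≫ f.inv).hom.hom z : X.obj.V) = z := by rw [f.hom_inv_id]; rfl
    exact h1
  change X.obj.ρ g x = x ↔ Y.obj.ρ g (f.hom.hom.hom x) = f.hom.hom.hom x
  constructor
  · intro h
    rw [← hom_ρ f.hom g x, h]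
  · intro h
    have h' := congrArg (fun y => (f.inv.hom.hom y : X.obj.V)) h
    simp only at h'
    rw [← hom_ρ f.hom g x, hinv, hinv] at h'
    exact h'

/-- The stabiliser of ANY coset in the object `Π/N` of `B^temp(Π)` (`N` open normal) is `N`.
[cite: MochizukiSemiAnbd2006, Rmk 3.1.2 p.33] -/
theorem stab_quotient_eq (hG : IsTempered G) [IsTopologicalGroup G] (N : Subgroup G) [N.Normal]
    (hN : IsOpen (N : Set G)) (q : G ⧸ N) :
    BTemp.stab ⟨Action.ofMulAction G (G ⧸ N), (temperedAction_quotient_iff hG N).mpr hN⟩ q = N := by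
  induction q using QuotientGroup.induction_on with
  | H z =>
    ext g
    change g • (QuotientGroup.mk z : G ⧸ N) = QuotientGroup.mk z ↔ g ∈ N
    rw [MulAction.Quotient.smul_mk, QuotientGroup.eq, smul_eq_mul, mul_inv_rev, mul_assoc]
    constructor
    · intro h
      have h' := ‹N.Normal›.conj_mem _ h z
      simpa using h'
    · intro h
      have h' := ‹N.Normal›.conj_mem _ (N.inv_mem h) z⁻¹
      simpa [mul_assoc] using h'

end BTemp

/-! ### Transport of an admissible quotient along an equality of subgroups -/

/-- If `U = N`, an open continuous surjection `U → H` with trivial kernel is one `N → H` with the same properties.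
[folklore] -/
private theorem exists_adm_of_eq {G H : Type u} [Group G] [TopologicalSpace G] [Group H] [TopologicalSpace H]
    {U N : Subgroup G} (h : U = N) (φ : U →ₜ* H) (hs : Function.Surjective φ) (ho : IsOpenMap φ)
    (hk : φ.toMonoidHom.ker = ⊥) :
    ∃ ψ : N →ₜ* H, Function.Surjective ψ ∧ IsOpenMap ψ ∧ ψ.toMonoidHom.ker = ⊥ := by
  subst h
  exact ⟨φ, hs, ho, hk⟩

/-! ### The tower -/

namespace SpecialFibreTower

variable {𝒢 : ProfiniteSemiGraph.{u}}

/-- **[SemiAnbd] Example 3.10 — the special-fibre tower EXISTS over `π₁^temp(𝒢)`, with fibres the covering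
semi-graphs of anabelioids of the levels.**  For `𝒢` with the hypotheses of Thm. 3.7 and strictly coherent, a chart
`c` (`π₁^temp(𝒢) = c.G`), and every antitone exhaustive sequence `N` of open normal finite-index subgroups of
`π₁^temp(𝒢)` stable under all automorphisms of the topological group: a `SpecialFibreTower c.G` with `T.N = N`,
`T.admKer i = 1`, `T.Gc i = 𝒢_{S_i}` for THE connected tempered covering `S_i` of `𝒢` whose chart image is
(isomorphic to) `π₁^temp(𝒢)/N_i`, chart `π₁^temp(𝒢_{S_i})`, admissible quotient the étale identification
`N_i = Stab ⥲ π₁^temp(𝒢_{S_i})` of Prop. 3.6 (v), and faithfulness by Prop. 3.6 (iv).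
[cite: MochizukiSemiAnbd2006, Ex 3.10 p.44] -/
theorem exists_of_coverings (h37 : 𝒢.Thm37Hypotheses) (hsc : 𝒢.IsStrictlyCoherent) (c : TemperedPiChart 𝒢)
    (N : ℕ → Subgroup c.G) (hanti : Antitone N) (hopen : ∀ i, IsOpen (N i : Set c.G))
    (hchar : ∀ (i) (φ : c.G ≃ₜ* c.G), (N i).map φ.toMulEquiv.toMonoidHom = N i)
    (hnormal : ∀ i, (N i).Normal) (hfi : ∀ i, (N i).FiniteIndex) (hexh : ∀ g : c.G, (∀ i, g ∈ N i) → g = 1) :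
    ∃ T : SpecialFibreTower c.G, T.N = N ∧ (∀ i, T.admKer i = ⊥) ∧
      ∀ i, ∃ (S : CovObj 𝒢) (hS : S.IsTempered),
        T.Gc i = S.coveringGraph ∧ IsConnectedObj (⟨S, hS⟩ : BTempCat 𝒢) ∧
        Nonempty (c.equiv.functor.obj ⟨S, hS⟩ ≅
          ⟨Action.ofMulAction c.G (c.G ⧸ N i), (temperedAction_quotient_iff c.isTempered (N i)).mpr (hopen i)⟩) := by
  classical
  haveI := c.secondCountableTopology
  have h36 : 𝒢.Prop36Hypotheses := h37.toProp36Hypotheses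
  have hcoh : 𝒢.IsCoherent := hsc.isCoherent
  have hslim : IsSlimGroup c.G := temperedPiSlim_holds 𝒢 h36 c
  -- the objects `π₁^temp(𝒢)/N_i` of `B^temp(π₁^temp(𝒢))`: connected (transitive)
  let Q : ℕ → BTemp c.G := fun i =>
    ⟨Action.ofMulAction c.G (c.G ⧸ N i), (temperedAction_quotient_iff c.isTempered (N i)).mpr (hopen i)⟩
  have hQconn : ∀ i, IsConnectedObj (Q i) := fun i => by
    refine isConnectedObj_of_transitive (Q i) (QuotientGroup.mk 1 : c.G ⧸ N i) fun x => ?_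
    induction x using QuotientGroup.induction_on with
    | H z =>
      refine ⟨z, ?_⟩
      change z • (QuotientGroup.mk 1 : c.G ⧸ N i) = QuotientGroup.mk z
      rw [MulAction.Quotient.smul_mk, smul_eq_mul, mul_one]
  -- the corresponding connected tempered coverings `S_i` of `𝒢`, their covering graphs, charts, admissible quotients
  have key : ∀ i, ∃ (S : CovObj 𝒢) (hS : S.IsTempered) (hSc : IsConnectedObj (⟨S, hS⟩ : BTempCat 𝒢))
      (_ : Nonempty (c.equiv.functor.obj ⟨S, hS⟩ ≅ Q i)) (cS : TemperedPiChart S.coveringGraph)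
      (adm : N i →ₜ* cS.G), Function.Surjective adm ∧ IsOpenMap adm ∧ adm.toMonoidHom.ker = ⊥ := by
    intro i
    let Sobj : BTempCat 𝒢 := c.equiv.inverse.obj (Q i)
    have hSc : IsConnectedObj Sobj := TemperoidTransport.isConnectedObj_functor_obj c.equiv.symm (hQconn i)
    let S : CovObj 𝒢 := Sobj.obj
    have hS : S.IsTempered := Sobj.property
    have hSc' : IsConnectedObj (⟨S, hS⟩ : BTempCat 𝒢) := hSc
    let iso : c.equiv.functor.obj ⟨S, hS⟩ ≅ Q i := c.equiv.counitIso.app (Q i)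
    have h37' : S.coveringGraph.Thm37Hypotheses := S.thm37Hypotheses_coveringGraph h37 hsc hS hSc'
    let cS : TemperedPiChart S.coveringGraph := S.coveringGraph.temperedPiChart h37'.toProp36Hypotheses
    -- a base point of the chart image and its stabiliser `= N_i`
    let x₀ : (c.equiv.functor.obj ⟨S, hS⟩).obj.V := iso.inv.hom.hom (QuotientGroup.mk 1 : c.G ⧸ N i)
    let ω₀ : BTemp.Orbits (c.equiv.functor.obj ⟨S, hS⟩) := BTemp.cl _ x₀
    obtain ⟨φ, ψ, hψφ, hφψ, -⟩ := CovObj.exists_chartGroup_compatIso h36 hcoh c S hS hSc' cS ω₀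
    have hUN : BTemp.stab (c.equiv.functor.obj ⟨S, hS⟩) (Quot.out ω₀) = N i := by
      ext g
      rw [BTemp.mem_stab_iff_of_iso iso]
      haveI := hnormal i
      rw [BTemp.stab_quotient_eq c.isTempered (N i) (hopen i)]
    -- `φ` is an open continuous surjection with trivial kernel (it has the continuous inverse `ψ`)
    have hsurj : Function.Surjective φ := fun y => ⟨ψ y, hφψ y⟩
    have hopenφ : IsOpenMap φ := by
      let e : ↥(BTemp.stab (c.equiv.functor.obj ⟨S, hS⟩) (Quot.out ω₀)) ≃ₜ cS.G :=
        { toFun := φ, invFun := ψ, left_inv := hψφ, right_inv := hφψ,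
          continuous_toFun := φ.continuous, continuous_invFun := ψ.continuous }
      exact e.isOpenMap
    have hker : φ.toMonoidHom.ker = ⊥ :=
      (MonoidHom.ker_eq_bot_iff _).mpr (Function.LeftInverse.injective hψφ)
    obtain ⟨adm, hs, ho, hk⟩ := exists_adm_of_eq hUN φ hsurj hopenφ hker
    exact ⟨S, hS, hSc', ⟨iso⟩, cS, adm, hs, ho, hk⟩
  choose S hS hSc hiso cS adm hsurj hopenMap hker using key
  refine ⟨{ N := N
            N_antitone := hanti
            isOpen_N := hopen
            N_char := hchar
            N_normal := hnormal
            N_finiteIndex := hfi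
            N_exhaustive := hexh
            Gc := fun i => (S i).coveringGraph
            hyp := fun i => (S i).thm37Hypotheses_coveringGraph h37 hsc (hS i) (hSc i)
            chart := fun i => cS i
            admKer := fun _ => ⊥
            admKer_le := fun _ => bot_le
            admKer_normal := fun _ => inferInstance
            admKer_antitone := fun _ _ _ => le_rfl
            adm := adm
            adm_surjective := hsurj
            isOpenMap_adm := hopenMap
            ker_adm := fun i => by rw [hker i, Subgroup.bot_subgroupOf]
            faithful := fun i g hg => ?_ }, rfl, fun _ => rfl,
          fun i => ⟨S i, hS i, rfl, hSc i, hiso i⟩⟩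
  -- an element centralising the open `N_i` is trivial (temp-slimness of `π₁^temp(𝒢)`, Prop. 3.6 (iv)), so lies in `N_i`
  have hz : g ∈ Subgroup.centralizer (N i : Set c.G) := by
    rw [Subgroup.mem_centralizer_iff]
    intro n hn
    have h := hg n hn
    rw [Subgroup.mem_bot] at h
    have : g * n = n * g := by
      calc g * n = g * n * g⁻¹ * n⁻¹ * (n * g) := by group
        _ = n * g := by rw [h, one_mul]
    exact this.symm
  rw [hslim.centralizer_eq_bot _ (hopen i), Subgroup.mem_bot] at hz
  rw [hz]; exact (N i).one_mem

/-- **The same over a FINITE coherent Thm-3.7 semi-graph of anabelioids** (strict coherence is automatic,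
[IUTchI] Rmk. 2.5.3 (i) (T3): "if `𝒢` is finite and coherent, then it is strictly coherent") — the regime of the
special fibres of curves. [cite: MochizukiSemiAnbd2006, Ex 3.10 p.44] -/
theorem exists_of_coverings_of_finite [Finite 𝒢.graph.Vertex] [Finite 𝒢.graph.Edge] (h37 : 𝒢.Thm37Hypotheses)
    (hcoh : 𝒢.IsCoherent) (c : TemperedPiChart 𝒢) (N : ℕ → Subgroup c.G) (hanti : Antitone N)
    (hopen : ∀ i, IsOpen (N i : Set c.G))
    (hchar : ∀ (i) (φ : c.G ≃ₜ* c.G), (N i).map φ.toMulEquiv.toMonoidHom = N i)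
    (hnormal : ∀ i, (N i).Normal) (hfi : ∀ i, (N i).FiniteIndex) (hexh : ∀ g : c.G, (∀ i, g ∈ N i) → g = 1) :
    ∃ T : SpecialFibreTower c.G, T.N = N ∧ (∀ i, T.admKer i = ⊥) ∧
      ∀ i, ∃ (S : CovObj 𝒢) (hS : S.IsTempered), T.Gc i = S.coveringGraph ∧ IsConnectedObj (⟨S, hS⟩ : BTempCat 𝒢) :=
  by
  obtain ⟨T, hN, hadm, hfib⟩ := exists_of_coverings h37 (isStrictlyCoherent_of_finite ⟨‹_›, ‹_›⟩ hcoh) c N hanti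
    hopen hchar hnormal hfi hexh
  exact ⟨T, hN, hadm, fun i => by
    obtain ⟨S, hS, hGc, hSc, -⟩ := hfib i
    exact ⟨S, hS, hGc, hSc⟩⟩

end SpecialFibreTower

end Literature.AnabelianGeometry.SemiGraphs

end
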